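import Mathlib
import HarnessLib

/-!
# The homogeneous self-dual embedding of a conic program: certificates and the three cases
# (O'Donoghue–Chu–Parikh–Boyd 2016, §1–§2; embedding of Ye–Todd–Mizuno 1994)

Topic `Literature/Analysis/Convex`.  Source: B. O'Donoghue, E. Chu, N. Parikh, S. Boyd, *Conic
optimization via operator splitting and homogeneous self-dual embedding*, J. Optim. Theory Appl.
169 (2016) 1042–1068, arXiv:1312.3039 [OCPB16] (bib `OdonoghueEtAl2016`; locators below are
SECTION numbers, common to the arXiv and the journal version; the held text `paper:arxiv-1312.3039`
is the arXiv LaTeX source in 3000-character chunks, §1–§2.3 = chunks 3–5, quotations below are from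
it): §1 (the primal–dual pair), §2.1 (optimality conditions = KKT), §2.2 (certificates of
infeasibility: the sets `𝒫, 𝒟, 𝒫̃, 𝒟̃`) and §2.3 (the homogeneous self-dual embedding of Ye, Todd
and Mizuno [OCPB16, ref. YT:94: *Math. Oper. Res.* 19 (1994) 53–67], its homogeneity and the three
cases `τ > 0`, `τ = 0 < κ`, `τ = κ = 0`).  This is the algebra behind the status words *solved / primal infeasible /
dual infeasible* returned by the first-order conic solvers built on the embedding (SCS, and the
same certificates in Clarabel, COSMO, …): every NONZERO solution of ONE homogeneous feasibility
problem either rescales to a primal–dual optimal pair or normalises to a certificate.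

The primal–dual pair [OCPB16, §1]:
`minimize cᵀx  s.t. Ax + s = b, (x, s) ∈ ℝⁿ × 𝒦`  and
`maximize −bᵀy s.t. −Aᵀy + r = c, (r, y) ∈ {0}ⁿ × 𝒦^*`,
data `A ∈ ℝ^{m×n}`, `b ∈ ℝ^m`, `c ∈ ℝ^n` and a convex cone `𝒦 ⊆ ℝ^m` with dual cone
`𝒦^* = {y | sᵀy ≥ 0 ∀ s ∈ 𝒦}`.

## Main definitions

* `ConeProgram m n` — the data `(A, b, c, 𝒦)`; `𝒦 : PointedCone ℝ (m → ℝ)` (Mathlib: a convex cone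
  containing `0`); `dualCone 𝒦 = 𝒦^*` is Mathlib's `PointedCone.dual` for the dot-product pairing.
* `IsPrimalFeasible P x s` (`Ax + s = b`, `s ∈ 𝒦`), `IsDualFeasible P y` (`Aᵀy + c = 0`, i.e. the
  dual residual `r = 0`, and `y ∈ 𝒦^*`), `IsKKTPoint P x s y` [OCPB16 §2.1].
* `IsPrimalInfeasibilityCert P y` (`y ∈ 𝒟`: `Aᵀy = 0, y ∈ 𝒦^*, bᵀy < 0`) and
  `IsDualInfeasibilityCert P x` (`x ∈ 𝒫̃`: `−Ax ∈ 𝒦, cᵀx < 0`) [OCPB16 §2.2].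
* `IsHSDESolution P x s y τ κ` — a solution of the homogeneous self-dual embedding [OCPB16 §2.3]:
  `r = Aᵀy + cτ = 0`, `s = −Ax + bτ ∈ 𝒦`, `κ = −cᵀx − bᵀy ≥ 0`, `y ∈ 𝒦^*`, `τ ≥ 0`
  (the dual residual `r ∈ {0}ⁿ` is eliminated; `s` and `κ` are kept with their defining equations).

## Main results (all proved; no named facts)

* `gap_eq_dotProduct`, `weak_duality` — for feasible `(x, s)` and `y` the duality gap is
  `cᵀx + bᵀy = sᵀy ≥ 0` [OCPB16 §1, "weak duality `d⋆ ≤ p⋆` with no assumptions on the data"];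
  `compl_iff_gap_eq_zero` — complementary slackness ⇔ zero gap [OCPB16 §2.1];
  `IsKKTPoint.primal_optimal`, `IsKKTPoint.dual_optimal` — a KKT point is primal–dual optimal.
* `IsPrimalInfeasibilityCert.not_isPrimalFeasible`, `IsDualInfeasibilityCert.not_isDualFeasible` —
  `y ∈ 𝒟` certifies `𝒫 = ∅`, `x ∈ 𝒫̃` certifies `𝒟̃ = ∅` [OCPB16 §2.2]; the improving-ray readings
  `IsPrimalInfeasibilityCert.isDualFeasible_add_smul`, `IsDualInfeasibilityCert.isPrimalFeasible_add_smul`.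
* `skew_identity` — `uᵀQu = 0` for the embedding matrix `Q` (skew-symmetric) [OCPB16 §2.3];
  `IsHSDESolution.dotProduct_eq_zero`, `IsHSDESolution.tau_mul_kappa` — for a solution, `sᵀy = 0`
  and `τκ = 0` ("`τ` and `κ` are nonnegative and complementary") [OCPB16 §2.3, p. 4].
* **The three cases** [OCPB16 §2.3, p. 4]: `IsHSDESolution.isKKTPoint_of_tau_pos` (`τ > 0`:
  `(x, s, y)/τ` is a KKT point, and `κ = 0`); `IsHSDESolution.gap_neg_of_kappa_pos`,
  `IsHSDESolution.isPrimalInfeasibilityCert`, `IsHSDESolution.isDualInfeasibilityCert`,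
  `IsHSDESolution.primal_or_dual_infeasible` (`τ = 0 < κ`: `cᵀx + bᵀy < 0`; `bᵀy < 0` gives the
  certificate `ŷ = y/(−bᵀy)` with `Aᵀŷ = 0, ŷ ∈ 𝒦^*, bᵀŷ = −1`; `cᵀx < 0` gives `x̂ = x/(−cᵀx)` with
  `−Ax̂ ∈ 𝒦, cᵀx̂ = −1`; hence the problem is primal or dual infeasible); `IsHSDESolution.zero`
  (`τ = κ = 0` carries no information: `0` is always a solution).
* `IsHSDESolution.smul` — homogeneity [OCPB16 §2.3, "the system is homogeneous"]; and the converse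
  embeddings `IsKKTPoint.isHSDESolution` (`τ = 1, κ = 0`: the plain embedding of the KKT conditions is the homogeneous one at `τ = 1`),
  `IsPrimalInfeasibilityCert.isHSDESolution`, `IsDualInfeasibilityCert.isHSDESolution`
  (`τ = 0`, `κ = −bᵀy` resp. `−cᵀx > 0`): every outcome is witnessed by a nonzero solution.

## Conventions and deviations

* CONE.  [OCPB16] take `𝒦` a nonempty closed convex cone.  Only `0 ∈ 𝒦`, convexity and closure
  under nonnegative scaling are used by the statements above, so `𝒦` is a Mathlib `PointedCone`
  ("pointed" in Mathlib's sense: contains `0`, not "salient"); closedness is NOT assumed and the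
  strong-alternative / strong-duality statements of §2.2 ("exactly one of `𝒫`, `𝒟` is nonempty",
  which needs strong duality) are deliberately NOT here — only their unconditional weak halves.
* DOT PRODUCTS.  `yᵀs` is written `s ⬝ᵥ y` (the order produced by `PointedCone.dual`); all pairings
  are Mathlib's `dotProduct` on `m → ℝ` / `n → ℝ`, matrices act by `Matrix.mulVec`.
* NOT HERE.  The ADMM iteration of §3 (SCS), its convergence (§3.4) and termination criteria (§3.5)
  — floating-point solver behaviour is not a Literature statement; the self-duality of the
  feasibility problem `find (u, v): v = Qu, (u, v) ∈ 𝒞 × 𝒞^*` as a Lagrangian computation (§2.3) is represented by the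
  skew-symmetry identity `skew_identity` only.  Related files: `LinearProgrammingDuality`
  (polyhedral `𝒦 = ℝ^m_+`, Schrijver), `Computation/Certificates/SDPStrongDuality`,
  `SemidefiniteRigorousBoundsEigenCount` (`𝒦 = S^n_+`, Jansson's certificates Prop. 8.1/8.2).
-/

namespace Literature.Analysis.Convex.SelfDualEmbedding

open Matrix

variable {m n : Type*}

/-- The data of the primal–dual pair of cone programs [OCPB16, §1]:
`minimize cᵀx s.t. Ax + s = b, (x, s) ∈ ℝⁿ × 𝒦` / `maximize −bᵀy s.t. −Aᵀy + r = c,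
(r, y) ∈ {0}ⁿ × 𝒦^*`, with `A ∈ ℝ^{m×n}`, `b ∈ ℝ^m`, `c ∈ ℝ^n` and the cone `𝒦 ⊆ ℝ^m`
(here any convex cone containing `0`). [cite: OdonoghueEtAl2016, §1] -/
structure ConeProgram (m n : Type*) where
  /-- the constraint matrix `A ∈ ℝ^{m×n}` -/
  A : Matrix m n ℝ
  /-- the right-hand side `b ∈ ℝ^m` -/
  b : m → ℝ
  /-- the cost vector `c ∈ ℝ^n` -/
  c : n → ℝ
  /-- the cone `𝒦 ⊆ ℝ^m` (convex, contains `0`) -/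
  K : PointedCone ℝ (m → ℝ)

variable [Fintype m] [Fintype n]

/-- The dual cone `𝒦^* = {y ∈ ℝ^m | sᵀy ≥ 0 for all s ∈ 𝒦}` [OCPB16, §1: "the set `𝒦` is a nonempty
closed convex cone with dual cone `𝒦^*`"] — Mathlib's `PointedCone.dual` for the dot-product
pairing `dotProductBilin`. [cite: OdonoghueEtAl2016, §1] -/
abbrev dualCone (K : PointedCone ℝ (m → ℝ)) : PointedCone ℝ (m → ℝ) :=
  PointedCone.dual (dotProductBilin ℝ ℝ) (K : Set (m → ℝ))

/-- Membership in the dual cone: `y ∈ 𝒦^* ↔ ∀ s ∈ 𝒦, 0 ≤ sᵀy`.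
[cite: OdonoghueEtAl2016, §1] -/
theorem mem_dualCone {K : PointedCone ℝ (m → ℝ)} {y : m → ℝ} :
    y ∈ dualCone K ↔ ∀ ⦃s : m → ℝ⦄, s ∈ K → 0 ≤ s ⬝ᵥ y :=
  PointedCone.mem_dual

/-- `(x, s)` is feasible for the primal problem of [OCPB16, §1]: `Ax + s = b` and `s ∈ 𝒦`
(the set `𝒫` of [OCPB16, §2.2]). [cite: OdonoghueEtAl2016, §1 and §2.2] -/
structure IsPrimalFeasible (P : ConeProgram m n) (x : n → ℝ) (s : m → ℝ) : Prop where
  /-- `Ax + s = b` -/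
  slack_eq : P.A *ᵥ x + s = P.b
  /-- `s ∈ 𝒦` -/
  slack_mem : s ∈ P.K

/-- `y` is feasible for the dual problem of [OCPB16, §1]: `−Aᵀy + r = c` with `r ∈ {0}ⁿ`, i.e.
`Aᵀy + c = 0` (the dual residual `r` is eliminated), and `y ∈ 𝒦^*`.
[cite: OdonoghueEtAl2016, §1] -/
structure IsDualFeasible (P : ConeProgram m n) (y : m → ℝ) : Prop where
  /-- `Aᵀy + c = 0` (`r = 0`) -/
  residual_eq : P.Aᵀ *ᵥ y + P.c = 0
  /-- `y ∈ 𝒦^*` -/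
  mem_dual : y ∈ dualCone P.K

/-- The KKT conditions [OCPB16, §2.1]: `(x, s)` primal feasible, `(r, y) = (0, y)` dual
feasible, and complementary slackness `yᵀs = 0`. [cite: OdonoghueEtAl2016, §2.1] -/
structure IsKKTPoint (P : ConeProgram m n) (x : n → ℝ) (s : m → ℝ) (y : m → ℝ) : Prop where
  /-- primal feasibility -/
  primal : IsPrimalFeasible P x s
  /-- dual feasibility -/
  dual : IsDualFeasible P y
  /-- complementary slackness `yᵀs = 0` -/
  compl : s ⬝ᵥ y = 0

/-- A certificate of primal infeasibility: a member of
`𝒟 = {y | Aᵀy = 0, y ∈ 𝒦^*, bᵀy < 0}` [OCPB16, §2.2].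
[cite: OdonoghueEtAl2016, §2.2] -/
structure IsPrimalInfeasibilityCert (P : ConeProgram m n) (y : m → ℝ) : Prop where
  /-- `Aᵀy = 0` -/
  residual_eq : P.Aᵀ *ᵥ y = 0
  /-- `y ∈ 𝒦^*` -/
  mem_dual : y ∈ dualCone P.K
  /-- `bᵀy < 0` -/
  obj_neg : P.b ⬝ᵥ y < 0

/-- A certificate of dual infeasibility: a member of `𝒫̃ = {x | −Ax ∈ 𝒦, cᵀx < 0}` [OCPB16, §2.2].
[cite: OdonoghueEtAl2016, §2.2] -/
structure IsDualInfeasibilityCert (P : ConeProgram m n) (x : n → ℝ) : Prop where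
  /-- `−Ax ∈ 𝒦` -/
  neg_mulVec_mem : -(P.A *ᵥ x) ∈ P.K
  /-- `cᵀx < 0` -/
  obj_neg : P.c ⬝ᵥ x < 0

/-- A solution of the HOMOGENEOUS SELF-DUAL EMBEDDING [OCPB16, §2.3] (Ye–Todd–Mizuno):
`(r, s, κ) = Q (x, y, τ)` with `Q = [[0, Aᵀ, c], [−A, 0, b], [−cᵀ, −bᵀ, 0]]`, i.e.
`r = Aᵀy + cτ`, `s = −Ax + bτ`, `κ = −cᵀx − bᵀy`, and
`(x, s, r, y, τ, κ) ∈ ℝⁿ × 𝒦 × {0}ⁿ × 𝒦^* × ℝ₊ × ℝ₊`.  The dual residual `r` (forced to be `0`) is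
eliminated; `s` and `κ` are kept as named components together with their defining equations.
[cite: OdonoghueEtAl2016, §2.3] -/
structure IsHSDESolution (P : ConeProgram m n) (x : n → ℝ) (s : m → ℝ) (y : m → ℝ) (τ κ : ℝ) :
    Prop where
  /-- `r = Aᵀy + cτ = 0` -/
  residual_eq : P.Aᵀ *ᵥ y + τ • P.c = 0
  /-- `s = −Ax + bτ` -/
  slack_eq : s = τ • P.b - P.A *ᵥ x
  /-- `κ = −cᵀx − bᵀy` -/
  kappa_eq : κ = -(P.c ⬝ᵥ x) - P.b ⬝ᵥ y
  /-- `s ∈ 𝒦` -/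
  slack_mem : s ∈ P.K
  /-- `y ∈ 𝒦^*` -/
  mem_dual : y ∈ dualCone P.K
  /-- `τ ≥ 0` -/
  tau_nonneg : 0 ≤ τ
  /-- `κ ≥ 0` -/
  kappa_nonneg : 0 ≤ κ

variable {P : ConeProgram m n} {x : n → ℝ} {s y : m → ℝ} {τ κ : ℝ}

/-- `(Aᵀy)ᵀx = yᵀ(Ax)`. [folklore] -/
private theorem transpose_mulVec_dotProduct (A : Matrix m n ℝ) (y : m → ℝ) (x : n → ℝ) :
    (Aᵀ *ᵥ y) ⬝ᵥ x = y ⬝ᵥ (A *ᵥ x) := by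
  rw [dotProduct_comm (Aᵀ *ᵥ y) x, dotProduct_mulVec, vecMul_transpose, dotProduct_comm]

/-- `xᵀ(Aᵀy) = yᵀ(Ax)`. [folklore] -/
private theorem dotProduct_transpose_mulVec (A : Matrix m n ℝ) (x : n → ℝ) (y : m → ℝ) :
    x ⬝ᵥ (Aᵀ *ᵥ y) = y ⬝ᵥ (A *ᵥ x) := by
  rw [dotProduct_comm x, transpose_mulVec_dotProduct]

/-! ### §1, §2.1 — weak duality and the KKT conditions -/

/-- For primal feasible `(x, s)` and dual feasible `y` the duality gap is the complementarity
product: `cᵀx + bᵀy = cᵀx − (−bᵀy) = yᵀs` (as `c = −Aᵀy` and `Ax = b − s`).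
[cite: OdonoghueEtAl2016, §1 and §2.1] -/
theorem gap_eq_dotProduct (hp : IsPrimalFeasible P x s) (hd : IsDualFeasible P y) :
    P.c ⬝ᵥ x + P.b ⬝ᵥ y = s ⬝ᵥ y := by
  have hc : P.c = -(P.Aᵀ *ᵥ y) := eq_neg_of_add_eq_zero_right hd.residual_eq
  have hAx : P.A *ᵥ x = P.b - s := eq_sub_of_add_eq hp.slack_eq
  have h1 : P.c ⬝ᵥ x = -(y ⬝ᵥ P.b) + y ⬝ᵥ s := by
    rw [hc, neg_dotProduct, transpose_mulVec_dotProduct, hAx, dotProduct_sub]; ring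
  rw [h1, dotProduct_comm y P.b, dotProduct_comm y s]; ring

/-- WEAK DUALITY, pointwise: the dual objective `−bᵀy` of a dual feasible `y` is at most the
primal objective `cᵀx` of a primal feasible `(x, s)` ("it is easy to show weak duality, i.e.
`d⋆ ≤ p⋆`, with no assumptions on the data"). [cite: OdonoghueEtAl2016, §1] -/
theorem weak_duality (hp : IsPrimalFeasible P x s) (hd : IsDualFeasible P y) :
    -(P.b ⬝ᵥ y) ≤ P.c ⬝ᵥ x := by
  have h := gap_eq_dotProduct hp hd
  have h0 : 0 ≤ s ⬝ᵥ y := mem_dualCone.mp hd.mem_dual hp.slack_mem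
  linarith

/-- [OCPB16, §2.1]: for feasible points "the complementary slackness condition can equivalently be
replaced by the condition `cᵀx⋆ + bᵀy⋆ = 0`, which explicitly forces the duality gap to be zero".
[cite: OdonoghueEtAl2016, §2.1] -/
theorem compl_iff_gap_eq_zero (hp : IsPrimalFeasible P x s) (hd : IsDualFeasible P y) :
    s ⬝ᵥ y = 0 ↔ P.c ⬝ᵥ x + P.b ⬝ᵥ y = 0 := by
  rw [gap_eq_dotProduct hp hd]

/-- A triple is a KKT point iff it is primal feasible, dual feasible and has zero duality gap
`cᵀx + bᵀy = 0`. [cite: OdonoghueEtAl2016, §2.1] -/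
theorem isKKTPoint_iff_gap_eq_zero :
    IsKKTPoint P x s y ↔ IsPrimalFeasible P x s ∧ IsDualFeasible P y ∧ P.c ⬝ᵥ x + P.b ⬝ᵥ y = 0 := by
  constructor
  · intro h
    exact ⟨h.primal, h.dual, (compl_iff_gap_eq_zero h.primal h.dual).mp h.compl⟩
  · rintro ⟨hp, hd, hg⟩
    exact ⟨hp, hd, (compl_iff_gap_eq_zero hp hd).mpr hg⟩

/-- A KKT point is PRIMAL OPTIMAL: its objective `cᵀx` is at most that of every primal feasible
point ("satisfies the KKT conditions, and so is primal-dual optimal"; the direction needing no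
strong duality). [cite: OdonoghueEtAl2016, §2.1] -/
theorem IsKKTPoint.primal_optimal (h : IsKKTPoint P x s y) {x' : n → ℝ} {s' : m → ℝ}
    (hp' : IsPrimalFeasible P x' s') : P.c ⬝ᵥ x ≤ P.c ⬝ᵥ x' := by
  have h0 := (compl_iff_gap_eq_zero h.primal h.dual).mp h.compl
  have h1 := weak_duality hp' h.dual
  linarith

/-- A KKT point is DUAL OPTIMAL: its dual objective `−bᵀy` is at least that of every dual feasible
point. [cite: OdonoghueEtAl2016, §2.1] -/
theorem IsKKTPoint.dual_optimal (h : IsKKTPoint P x s y) {y' : m → ℝ} (hd' : IsDualFeasible P y') :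
    -(P.b ⬝ᵥ y') ≤ -(P.b ⬝ᵥ y) := by
  have h0 := (compl_iff_gap_eq_zero h.primal h.dual).mp h.compl
  have h1 := weak_duality h.primal hd'
  linarith

/-! ### §2.2 — certificates of infeasibility (weak alternatives) -/

/-- "Any dual variable `y ∈ 𝒟` serves as a proof or certificate that the set `𝒫` is empty, i.e.
that the problem is primal infeasible": `bᵀy = (Ax + s)ᵀy = xᵀ(Aᵀy) + sᵀy = sᵀy ≥ 0` would
contradict `bᵀy < 0`.  (Weak half of the theorem of strong alternatives; no strong duality needed.)
[cite: OdonoghueEtAl2016, §2.2] -/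
theorem IsPrimalInfeasibilityCert.not_isPrimalFeasible (hy : IsPrimalInfeasibilityCert P y)
    (x : n → ℝ) (s : m → ℝ) : ¬ IsPrimalFeasible P x s := by
  intro hp
  have h0 : 0 ≤ s ⬝ᵥ y := mem_dualCone.mp hy.mem_dual hp.slack_mem
  have h1 : P.b ⬝ᵥ y = s ⬝ᵥ y := by
    rw [← hp.slack_eq, add_dotProduct, dotProduct_comm (P.A *ᵥ x) y,
      ← dotProduct_transpose_mulVec, hy.residual_eq, dotProduct_zero, zero_add]
  linarith [hy.obj_neg]

/-- "Any primal variable `x ∈ 𝒫̃` is a certificate of dual infeasibility":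
`0 ≤ (−Ax)ᵀy = −xᵀ(Aᵀy) = xᵀc = cᵀx < 0` is absurd for a dual feasible `y`.
[cite: OdonoghueEtAl2016, §2.2] -/
theorem IsDualInfeasibilityCert.not_isDualFeasible (hx : IsDualInfeasibilityCert P x)
    (y : m → ℝ) : ¬ IsDualFeasible P y := by
  intro hd
  have h0 : 0 ≤ (-(P.A *ᵥ x)) ⬝ᵥ y := mem_dualCone.mp hd.mem_dual hx.neg_mulVec_mem
  have hc : P.c = -(P.Aᵀ *ᵥ y) := eq_neg_of_add_eq_zero_right hd.residual_eq
  have h1 : (-(P.A *ᵥ x)) ⬝ᵥ y = P.c ⬝ᵥ x := by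
    rw [neg_dotProduct, dotProduct_comm (P.A *ᵥ x) y, ← dotProduct_transpose_mulVec, hc,
      neg_dotProduct, dotProduct_comm]
  linarith [hx.obj_neg]

omit [Fintype n] in
/-- "The set `𝒟` encodes the requirements for the dual problem to be feasible but unbounded": a
certificate `d ∈ 𝒟` is an improving ray of the dual — `y₀ + t d` stays dual feasible for `t ≥ 0`
and its dual objective is `−bᵀy₀ + t (−bᵀd)` with `−bᵀd > 0`. [cite: OdonoghueEtAl2016, §2.2] -/
theorem IsPrimalInfeasibilityCert.isDualFeasible_add_smul {d y₀ : m → ℝ}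
    (hd : IsPrimalInfeasibilityCert P d) (h₀ : IsDualFeasible P y₀) {t : ℝ} (ht : 0 ≤ t) :
    IsDualFeasible P (y₀ + t • d) ∧ -(P.b ⬝ᵥ (y₀ + t • d)) = -(P.b ⬝ᵥ y₀) + t * (-(P.b ⬝ᵥ d)) := by
  refine ⟨⟨?_, ?_⟩, ?_⟩
  · rw [mulVec_add, mulVec_smul, hd.residual_eq, smul_zero, add_zero, h₀.residual_eq]
  · exact (dualCone P.K).add_mem h₀.mem_dual ((dualCone P.K).smul_mem ht hd.mem_dual)
  · rw [dotProduct_add, dotProduct_smul, smul_eq_mul]; ring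

omit [Fintype m] in
/-- Dually, a certificate `x̂ ∈ 𝒫̃` is an improving ray of the primal: `(x₀ + t x̂, s₀ + t(−Ax̂))`
stays primal feasible for `t ≥ 0` and its objective is `cᵀx₀ + t cᵀx̂` with `cᵀx̂ < 0` (the primal
is unbounded below if feasible). [cite: OdonoghueEtAl2016, §2.2] -/
theorem IsDualInfeasibilityCert.isPrimalFeasible_add_smul {d x₀ : n → ℝ} {s₀ : m → ℝ}
    (hd : IsDualInfeasibilityCert P d) (h₀ : IsPrimalFeasible P x₀ s₀) {t : ℝ} (ht : 0 ≤ t) :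
    IsPrimalFeasible P (x₀ + t • d) (s₀ + t • (-(P.A *ᵥ d))) ∧
      P.c ⬝ᵥ (x₀ + t • d) = P.c ⬝ᵥ x₀ + t * (P.c ⬝ᵥ d) := by
  refine ⟨⟨?_, ?_⟩, ?_⟩
  · rw [mulVec_add, mulVec_smul, smul_neg, add_add_add_comm, add_neg_cancel, add_zero, h₀.slack_eq]
  · exact P.K.add_mem h₀.slack_mem (P.K.smul_mem ht hd.neg_mulVec_mem)
  · rw [dotProduct_add, dotProduct_smul, smul_eq_mul]

/-! ### §2.3 — the homogeneous self-dual embedding -/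

/-- SKEW-SYMMETRY of the embedding: `uᵀ(Qu) = 0` for every `u = (x, y, τ)`, written out as
`xᵀ(Aᵀy + cτ) + yᵀ(−Ax + bτ) + τ(−cᵀx − bᵀy) = 0` ("`Qᵀ = −Q`"; "the matrix `Q` is
skew-symmetric"). [cite: OdonoghueEtAl2016, §2.3] -/
theorem skew_identity (P : ConeProgram m n) (x : n → ℝ) (y : m → ℝ) (τ : ℝ) :
    x ⬝ᵥ (P.Aᵀ *ᵥ y + τ • P.c) + y ⬝ᵥ (τ • P.b - P.A *ᵥ x) + τ * (-(P.c ⬝ᵥ x) - P.b ⬝ᵥ y) = 0 := by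
  rw [dotProduct_add, dotProduct_sub, dotProduct_smul, dotProduct_smul, smul_eq_mul, smul_eq_mul,
    dotProduct_transpose_mulVec, dotProduct_comm x P.c, dotProduct_comm y P.b]
  ring

/-- The zero vector is always a solution of the embedding ("of course we are interested in finding
a nonzero solution"; the case `τ = κ = 0` carries no information about the pair).
[cite: OdonoghueEtAl2016, §2.3] -/
theorem IsHSDESolution.zero (P : ConeProgram m n) : IsHSDESolution P 0 0 0 0 0 where
  residual_eq := by rw [mulVec_zero, zero_smul, add_zero]
  slack_eq := by rw [zero_smul, mulVec_zero, sub_zero]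
  kappa_eq := by rw [dotProduct_zero, dotProduct_zero, neg_zero, sub_zero]
  slack_mem := P.K.zero_mem
  mem_dual := (dualCone P.K).zero_mem
  tau_nonneg := le_rfl
  kappa_nonneg := le_rfl

/-- For a solution of the embedding, `sᵀy + τκ = uᵀv = uᵀQu = 0`.
[cite: OdonoghueEtAl2016, §2.3] -/
theorem IsHSDESolution.dotProduct_add_mul_eq_zero (h : IsHSDESolution P x s y τ κ) :
    s ⬝ᵥ y + τ * κ = 0 := by
  have h0 := skew_identity P x y τ
  rw [h.residual_eq, dotProduct_zero, zero_add, ← h.slack_eq, ← h.kappa_eq, dotProduct_comm y s]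
    at h0
  exact h0

/-- For a solution of the embedding the slack and the dual variable are complementary: `sᵀy = 0`
(both `sᵀy` and `τκ` are nonnegative and sum to `0`). [cite: OdonoghueEtAl2016, §2.3] -/
theorem IsHSDESolution.dotProduct_eq_zero (h : IsHSDESolution P x s y τ κ) : s ⬝ᵥ y = 0 := by
  have h0 := h.dotProduct_add_mul_eq_zero
  have h1 : 0 ≤ s ⬝ᵥ y := mem_dualCone.mp h.mem_dual h.slack_mem
  have h2 : 0 ≤ τ * κ := mul_nonneg h.tau_nonneg h.kappa_nonneg
  linarith

/-- "`τ` and `κ` are nonnegative and complementary (i.e. at most one is nonzero)": `τκ = 0`.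
[cite: OdonoghueEtAl2016, §2.3] -/
theorem IsHSDESolution.tau_mul_kappa (h : IsHSDESolution P x s y τ κ) : τ * κ = 0 := by
  have h0 := h.dotProduct_add_mul_eq_zero
  have h1 : 0 ≤ s ⬝ᵥ y := mem_dualCone.mp h.mem_dual h.slack_mem
  have h2 : 0 ≤ τ * κ := mul_nonneg h.tau_nonneg h.kappa_nonneg
  linarith

/-- At most one of `τ`, `κ` is nonzero. [cite: OdonoghueEtAl2016, §2.3] -/
theorem IsHSDESolution.tau_eq_zero_or_kappa_eq_zero (h : IsHSDESolution P x s y τ κ) :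
    τ = 0 ∨ κ = 0 :=
  mul_eq_zero.mp h.tau_mul_kappa

/-- CASE `τ > 0` forces `κ = 0`. [cite: OdonoghueEtAl2016, §2.3] -/
theorem IsHSDESolution.kappa_eq_zero_of_tau_pos (h : IsHSDESolution P x s y τ κ) (hτ : 0 < τ) :
    κ = 0 :=
  (h.tau_eq_zero_or_kappa_eq_zero).resolve_left hτ.ne'

/-- CASE `τ > 0` (and `κ = 0`): "the point `(x̂, ŷ, ŝ) = (x/τ, y/τ, s/τ)` satisfies the KKT
conditions [...] and so is a primal–dual solution". [cite: OdonoghueEtAl2016, §2.3] -/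
theorem IsHSDESolution.isKKTPoint_of_tau_pos (h : IsHSDESolution P x s y τ κ) (hτ : 0 < τ) :
    IsKKTPoint P (τ⁻¹ • x) (τ⁻¹ • s) (τ⁻¹ • y) where
  primal :=
    { slack_eq := by
        rw [mulVec_smul, h.slack_eq, ← smul_add, add_sub_cancel, smul_smul, inv_mul_cancel₀ hτ.ne',
          one_smul]
      slack_mem := P.K.smul_mem (inv_nonneg.mpr hτ.le) h.slack_mem }
  dual :=
    { residual_eq := by
        have h1 : P.Aᵀ *ᵥ (τ⁻¹ • y) + P.c = τ⁻¹ • (P.Aᵀ *ᵥ y + τ • P.c) := by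
          rw [mulVec_smul, smul_add, smul_smul, inv_mul_cancel₀ hτ.ne', one_smul]
        rw [h1, h.residual_eq, smul_zero]
      mem_dual := (dualCone P.K).smul_mem (inv_nonneg.mpr hτ.le) h.mem_dual }
  compl := by
    rw [smul_dotProduct, dotProduct_smul, smul_eq_mul, smul_eq_mul, h.dotProduct_eq_zero, mul_zero,
      mul_zero]

/-- CASE `κ > 0` (and `τ = 0`): "this implies that the gap `cᵀx + bᵀy` is negative" (it equals
`−κ`). [cite: OdonoghueEtAl2016, §2.3] -/
theorem IsHSDESolution.gap_neg_of_kappa_pos (h : IsHSDESolution P x s y τ κ) (hκ : 0 < κ) :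
    P.c ⬝ᵥ x + P.b ⬝ᵥ y < 0 := by
  have h0 := h.kappa_eq
  linarith

/-- CASE `κ > 0` forces `τ = 0`. [cite: OdonoghueEtAl2016, §2.3] -/
theorem IsHSDESolution.tau_eq_zero_of_kappa_pos (h : IsHSDESolution P x s y τ κ) (hκ : 0 < κ) :
    τ = 0 :=
  (h.tau_eq_zero_or_kappa_eq_zero).resolve_right hκ.ne'

/-- At `τ = 0` the residual equation reads `Aᵀy = 0`. [cite: OdonoghueEtAl2016, §2.3] -/
theorem IsHSDESolution.transpose_mulVec_eq_zero (h : IsHSDESolution P x s y τ κ) (hτ : τ = 0) :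
    P.Aᵀ *ᵥ y = 0 := by
  have h0 := h.residual_eq
  rwa [hτ, zero_smul, add_zero] at h0

/-- At `τ = 0` the slack is `s = −Ax ∈ 𝒦`. [cite: OdonoghueEtAl2016, §2.3] -/
theorem IsHSDESolution.neg_mulVec_mem (h : IsHSDESolution P x s y τ κ) (hτ : τ = 0) :
    -(P.A *ᵥ x) ∈ P.K := by
  have h0 := h.slack_mem
  rwa [h.slack_eq, hτ, zero_smul, zero_sub] at h0

/-- CASE `τ = 0`, `bᵀy < 0`: "`ŷ = y/(−bᵀy)` is a certificate of primal infeasibility (i.e. `𝒟` is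
nonempty) since `Aᵀŷ = 0, ŷ ∈ 𝒦^*, bᵀŷ = −1`". [cite: OdonoghueEtAl2016, §2.3] -/
theorem IsHSDESolution.isPrimalInfeasibilityCert (h : IsHSDESolution P x s y τ κ) (hτ : τ = 0)
    (hb : P.b ⬝ᵥ y < 0) : IsPrimalInfeasibilityCert P ((-(P.b ⬝ᵥ y))⁻¹ • y) where
  residual_eq := by rw [mulVec_smul, h.transpose_mulVec_eq_zero hτ, smul_zero]
  mem_dual := (dualCone P.K).smul_mem (inv_nonneg.mpr (by linarith)) h.mem_dual
  obj_neg := by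
    rw [dotProduct_smul, smul_eq_mul]
    exact mul_neg_of_pos_of_neg (inv_pos.mpr (by linarith)) hb

omit [Fintype n] in
/-- … and the certificate is normalised: `bᵀŷ = −1`. [cite: OdonoghueEtAl2016, §2.3] -/
theorem IsHSDESolution.dotProduct_primalCert (hb : P.b ⬝ᵥ y < 0) :
    P.b ⬝ᵥ ((-(P.b ⬝ᵥ y))⁻¹ • y) = -1 := by
  rw [dotProduct_smul, smul_eq_mul, inv_neg, neg_mul, inv_mul_cancel₀ hb.ne]

/-- CASE `τ = 0`, `cᵀx < 0`: "`x̂ = x/(−cᵀx)` is a certificate of dual infeasibility (i.e. `𝒫̃` is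
nonempty) since `−Ax̂ ∈ 𝒦, cᵀx̂ = −1`". [cite: OdonoghueEtAl2016, §2.3] -/
theorem IsHSDESolution.isDualInfeasibilityCert (h : IsHSDESolution P x s y τ κ) (hτ : τ = 0)
    (hc : P.c ⬝ᵥ x < 0) : IsDualInfeasibilityCert P ((-(P.c ⬝ᵥ x))⁻¹ • x) where
  neg_mulVec_mem := by
    rw [mulVec_smul, ← smul_neg]
    exact P.K.smul_mem (inv_nonneg.mpr (by linarith)) (h.neg_mulVec_mem hτ)
  obj_neg := by
    rw [dotProduct_smul, smul_eq_mul]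
    exact mul_neg_of_pos_of_neg (inv_pos.mpr (by linarith)) hc

omit [Fintype m] in
/-- … and the certificate is normalised: `cᵀx̂ = −1`. [cite: OdonoghueEtAl2016, §2.3] -/
theorem IsHSDESolution.dotProduct_dualCert (hc : P.c ⬝ᵥ x < 0) :
    P.c ⬝ᵥ ((-(P.c ⬝ᵥ x))⁻¹ • x) = -1 := by
  rw [dotProduct_smul, smul_eq_mul, inv_neg, neg_mul, inv_mul_cancel₀ hc.ne]

/-- CASE `τ = 0 < κ`, conclusion: "if `κ` is nonzero, then the original problem is primal or dual
infeasible" — since `cᵀx + bᵀy < 0`, one of `bᵀy < 0` (then `𝒫 = ∅` by the certificate `ŷ`) or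
`cᵀx < 0` (then no dual feasible point, by `x̂`) holds. ("If both, the problem is both primal and
dual infeasible.") [cite: OdonoghueEtAl2016, §2.3] -/
theorem IsHSDESolution.primal_or_dual_infeasible (h : IsHSDESolution P x s y τ κ) (hτ : τ = 0)
    (hκ : 0 < κ) :
    (∀ x' : n → ℝ, ∀ s' : m → ℝ, ¬ IsPrimalFeasible P x' s') ∨ (∀ y' : m → ℝ, ¬ IsDualFeasible P y') := by
  have hgap := h.gap_neg_of_kappa_pos hκ
  by_cases hb : P.b ⬝ᵥ y < 0
  · exact Or.inl fun x' s' => (h.isPrimalInfeasibilityCert hτ hb).not_isPrimalFeasible x' s'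
  · have hc : P.c ⬝ᵥ x < 0 := by linarith [not_lt.mp hb]
    exact Or.inr fun y' => (h.isDualInfeasibilityCert hτ hc).not_isDualFeasible y'

/-- HOMOGENEITY: "if `(x, s, r, y, τ, κ)` is a solution to the embedding, then so is
`(tx, ts, tr, ty, tτ, tκ)` for any `t ≥ 0`". [cite: OdonoghueEtAl2016, §2.3] -/
theorem IsHSDESolution.smul (h : IsHSDESolution P x s y τ κ) {t : ℝ} (ht : 0 ≤ t) :
    IsHSDESolution P (t • x) (t • s) (t • y) (t * τ) (t * κ) where
  residual_eq := by
    have h1 : P.Aᵀ *ᵥ (t • y) + (t * τ) • P.c = t • (P.Aᵀ *ᵥ y + τ • P.c) := by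
      rw [mulVec_smul, smul_add, smul_smul]
    rw [h1, h.residual_eq, smul_zero]
  slack_eq := by rw [h.slack_eq, smul_sub, smul_smul, mulVec_smul]
  kappa_eq := by rw [h.kappa_eq, dotProduct_smul, dotProduct_smul, smul_eq_mul, smul_eq_mul]; ring
  slack_mem := P.K.smul_mem ht h.slack_mem
  mem_dual := (dualCone P.K).smul_mem ht h.mem_dual
  tau_nonneg := mul_nonneg ht h.tau_nonneg
  kappa_nonneg := mul_nonneg ht h.kappa_nonneg

/-- Converse embedding of an optimal pair: a KKT point of the pair is a solution of the embedding with
`τ = 1`, `κ = 0` ("if `τ = 1` and `κ = 0`, the self-dual embedding reduces to the simpler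
embedding", i.e. to the KKT conditions themselves). [cite: OdonoghueEtAl2016, §2.3] -/
theorem IsKKTPoint.isHSDESolution (h : IsKKTPoint P x s y) : IsHSDESolution P x s y 1 0 where
  residual_eq := by rw [one_smul]; exact h.dual.residual_eq
  slack_eq := by rw [one_smul]; exact eq_sub_of_add_eq' h.primal.slack_eq
  kappa_eq := by
    have h0 := (compl_iff_gap_eq_zero h.primal h.dual).mp h.compl
    linarith
  slack_mem := h.primal.slack_mem
  mem_dual := h.dual.mem_dual
  tau_nonneg := zero_le_one
  kappa_nonneg := le_rfl

/-- Converse embedding of a primal-infeasibility certificate `y ∈ 𝒟`: `(0, 0, y)` with `τ = 0`,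
`κ = −bᵀy > 0` solves the embedding (so the outcome "primal infeasible" is witnessed by a nonzero
solution with `κ > 0`). [cite: OdonoghueEtAl2016, §2.3] -/
theorem IsPrimalInfeasibilityCert.isHSDESolution (h : IsPrimalInfeasibilityCert P y) :
    IsHSDESolution P 0 0 y 0 (-(P.b ⬝ᵥ y)) where
  residual_eq := by rw [zero_smul, add_zero]; exact h.residual_eq
  slack_eq := by rw [zero_smul, mulVec_zero, sub_zero]
  kappa_eq := by rw [dotProduct_zero, neg_zero, zero_sub]
  slack_mem := P.K.zero_mem
  mem_dual := h.mem_dual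
  tau_nonneg := le_rfl
  kappa_nonneg := by linarith [h.obj_neg]

/-- Converse embedding of a dual-infeasibility certificate `x ∈ 𝒫̃`: `(x, −Ax, 0)` with `τ = 0`,
`κ = −cᵀx > 0` solves the embedding. [cite: OdonoghueEtAl2016, §2.3] -/
theorem IsDualInfeasibilityCert.isHSDESolution (h : IsDualInfeasibilityCert P x) :
    IsHSDESolution P x (-(P.A *ᵥ x)) 0 0 (-(P.c ⬝ᵥ x)) where
  residual_eq := by rw [mulVec_zero, zero_smul, add_zero]
  slack_eq := by rw [zero_smul, zero_sub]
  kappa_eq := by rw [dotProduct_zero, sub_zero]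
  slack_mem := h.neg_mulVec_mem
  mem_dual := (dualCone P.K).zero_mem
  tau_nonneg := le_rfl
  kappa_nonneg := by linarith [h.obj_neg]

end Literature.Analysis.Convex.SelfDualEmbedding
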